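import Summits.HodgeConjecture.HodgeConjecture.Theorems.Ring2HypothesesFlatSectionsAnchored
import Literature.AlgebraicGeometry.HodgeTheory.HodgeTypeOfFlatSectionsProjectiveTotal
import HarnessLib

/-!
# Ring 2 — hypotheses layer, row b04: Charles–Schnell Conj. 11.3.1 AS PRINTED as named nodes (anchored forms); on compact pencils the anchored form needs NO partie fixe

HONEST FRAMING: research route conditional on HC_CM; not a corollary; Q11.4-sentence-2 already refuted in dim ≥ 3.

Cell `pub-hodge-ring2`, binder seat `ring2-b04` (gen 12), row b04 of `BINDER-OWNERS.md` (`Ring2.Hypotheses.FlatSectionsAlgebraic`,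
part I :327; OPEN, ≡ b03 = item 1076 `VHC` by the hypothesis-free `flatSectionsAlgebraic_iff_vhc`). `HC_CM` is the declaration
`Theses.RankFourFaces.CMAbelianHodge` and occurs below ONLY as a hypothesis `(hCM : …)`, as a conclusion of an honest-column
implication from open inputs, or inside an `↔` whose other side is `HC_AV`; nothing here proves a case of the Hodge
conjecture; no named fact is introduced; «BINDERS OF RECORD 10 · DISCHARGED 0» is unchanged. LEAD L44.15 (iv): "the
anchored-QP statement prints inline (no node unless b04 names a `def` in node scope — their call)" — named here, with what
the kernel knows about it.

§1 NODES (`@[conjecture] def`, obligation nodes, never asserted):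
* `AnchoredFlatSectionsQP` — **Conj. 11.3.1 AS PRINTED** (p. 468: "`α` is the cohomology class of some codimension `p`
  algebraic cycle … extends as a section `α̃` of the local system `R²ᵖπ_*ℚ(p)` … CONJECTURE: `α̃_s` is the class of an
  algebraic cycle for all `s`") on the printed carriers (`𝒳`, `S` quasi-projective, `S` smooth irreducible): hypotheses AT
  THE ANCHOR ONLY. Symbol for symbol the file-local notation `AnchoredQP[]` of part b04-gen-9
  (`Ring2HypothesesFlatSectionsAnchored`). The tree's `FlatSectionsAlgebraicQP` (part XXVII) adds "`σ(s)` rational `(p,p)` at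
  EVERY `s`".
* `AnchoredVariationalHodgeQP` — the same for a class `A ∈ H²ᵖ(𝒳(ℂ); ℂ)` of the total space (anchored form of part
  XXVII's `VariationalHodgeQP` / item 1076; the shape of Charles–Schnell's arguments, "`α̃_s = i_s^*(a)`").
* `AnchoredCompactAbelianPencilVHC` — the anchored form on André's COMPACT PENCILS of abelian varieties
  (`Motives.IsCompactAbelianPencil f d`), i.e. of the deform seat's `Ring2.Deform.CompactAbelianPencilVHC`.

§2 FACT-FREE: `AnchoredFlatSectionsQP ↔ AnchoredVariationalHodgeQP` (a flat section on the printed carriers IS the global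
section of one class of the open total space: Deligne 1968 / Voisin II Thm. 4.18 — the tree THEOREM
`deligne1968_invariantClass_fromTotalSpace_holds` — plus the identity principle, part XXVII
`exists_globalSection_eq_of_flatSection`); restriction `AnchoredVariationalHodgeQP ⟹ AnchoredCompactAbelianPencilVHC`.

§3 **ON COMPACT PENCILS THE ANCHORED FORM NEEDS NO PARTIE FIXE: `Ring2.Deform.CompactAbelianPencilVHC ↔
AnchoredCompactAbelianPencilVHC`, fact-free.** The only difference between an anchored form and its Hodge-everywhere
form is Deligne's (4.1.3.1) / Charles–Schnell Prop. 11.3.5 (1), which on the open printed carriers is the global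
invariant cycle theorem (ii) — the undischarged named fact `deligne_globalInvariantCycles` (C-row c17). When the total
space is a smooth projective variety, `X̄ = 𝒳` and (4.1.3.1) holds OUTRIGHT (Literature
`HodgeTypeOfFlatSectionsProjectiveTotal`, this seat). Consequences by name from the deform seat's part XVIII:
`HC_AV ↔ HC_CM ∧ AnchoredCompactAbelianPencilVHC` modulo André 1996 Lemme 6.3.1 ONLY (`HC_CM` a genuine factor),
`HC_AV ↔ AnchoredCompactAbelianPencilVHC` modulo Lemmes 6.3.1–6.3.3, item 16267 `CMToAbelian ↔ (HC_CM →
AnchoredCompactAbelianPencilVHC)` modulo Lemme 6.3.1; ON-PATH fact-free.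

§4 MODULO c17 on the printed carriers: `FlatSectionsAlgebraicQP ↔ AnchoredFlatSectionsQP` (part b04-gen-9 by name),
`VariationalHodgeQP ↔ AnchoredVariationalHodgeQP`; from `FlatSectionsAlgebraic`, `VHC`, the summit. ROWS: `HC_CM ∧ AnchoredX
⟹ HC_AV` modulo Lemme 6.3.1 for each node; `AnchoredX ⟹ HC_AV` modulo Lemmes 6.3.1–6.3.3 with NO `HC_CM`; honest column
`AnchoredVariationalHodgeQP ⟹ HC_CM` modulo {André 1992, Deligne's Weil families, R3anc}.

What is NOT claimed: any node; (4.1.3.1) on non-compact carriers; anything about `HC_CM` beyond the above. KIND of row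
b04 unchanged (OPEN; ≡ b03). Sources: [CharlesSchnell2014Notes] Conj. 11.3.1, Thm. 11.3.4, Prop. 11.3.5 (1), Cor. 11.3.6;
[DeligneHodgeII1971] Thm. 4.1.1, Cor. 4.1.2, (4.1.3.1); [Deligne1968] Prop. (2.1); [VoisinHodgeII2003] Thm. 4.18, Lemma 4.17;
[Grothendieck1966] fn. 13; [Andre1996Motifs] §6.3; [Abdulali1994FamiliesAV] (1.1).
-/

-- every declaration of this problem lives in `Summit.HodgeConjecture.HodgeConjecture.…` (summit = sub-problem)
set_option linter.dupNamespace false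

noncomputable section

open CategoryTheory AlgebraicGeometry
open Literature.AlgebraicGeometry Literature.AlgebraicGeometry.Motives
open Literature.AlgebraicGeometry.HodgeTheory
open Literature.AlgebraicGeometry.Andre1996 (andre1996_cmAnchoredPencil
  andre1996_cmHodgeClasses_algebraicallyAnchoredPencils compactPencil_irreducibleSpace_base
  compactPencil_smooth_base)

namespace Summit.HodgeConjecture.HodgeConjecture.Ring2.Hypotheses

/-! ## §1 The nodes -/

/-- **`AnchoredFlatSectionsQP` — Charles–Schnell Conj. 11.3.1 AS PRINTED, on the printed carriers.** For
`f : 𝒳 ⟶ S` a smooth projective family of relative dimension `n` with `𝒳` and `S` quasi-projective over `ℂ`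
and `S` smooth irreducible ("`π : 𝒳 → S` a smooth projective morphism of quasi-projective complex varieties",
"`S` smooth connected"), every continuous section `σ` of the espace étalé `FiberClass f (2p) → S(ℂ)` of
`R²ᵖf_*ℂ` ("`α` extends as a section `α̃` of the local system") and every `s₀` at which `σ(s₀)` is a RATIONAL
ALGEBRAIC class ("`α` is the cohomology class of some codimension `p` algebraic cycle"): `σ(s)` is algebraic
for every `s`. Hypotheses AT THE ANCHOR ONLY — no "Hodge class at every `s`" clause (that clause is
Prop. 11.3.5 (1), i.e. the partie fixe; the tree's `FlatSectionsAlgebraicQP` carries it). Symbol for symbol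
the file-local notation `AnchoredQP[]` of part b04-gen-9. OPEN ("Very little seems to be known about the
variational Hodge conjecture"); a HYPOTHESIS wherever used, never asserted.
[cite: CharlesSchnell2014Notes, Conj. 11.3.1 (p. 468) (= arXiv:1101.3647 Conj. 30)] [cite: Grothendieck1966, footnote 13] -/
@[conjecture] def AnchoredFlatSectionsQP : Prop :=
  ∀ ⦃n : ℕ⦄ ⦃𝒳 S : SchemeOver ℂ⦄ (f : 𝒳 ⟶ S), IsSmoothProjectiveFamily f n →
    IsQuasiProjectiveOver 𝒳 → IsQuasiProjectiveOver S → IrreducibleSpace S.left →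
    AlgebraicGeometry.Smooth S.hom →
    ∀ (p : ℕ) (σ : ComplexPoints S → FiberClass f (2 * p)), Continuous σ → (∀ s, (σ s).pt = s) →
      ∀ s₀ : ComplexPoints S, IsRationalClass (σ s₀).cls →
        (σ s₀).cls ∈ algebraicClasses (fiberOver f (σ s₀).pt) p →
        ∀ s : ComplexPoints S, (σ s).cls ∈ algebraicClasses (fiberOver f (σ s).pt) p

/-- **`AnchoredVariationalHodgeQP` — the anchored GLOBAL-CLASS form on the printed carriers**: same family
hypotheses; for every class `A ∈ H²ᵖ(𝒳(ℂ); ℂ)` of the (open) total space and every `s₀` at which `A|_{𝒳_{s₀}}`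
is a rational algebraic class, `A|_{𝒳_s}` is algebraic for every `s`. The anchored form of part XXVII's
`VariationalHodgeQP` (which also asks `A|_{𝒳_s}` rational `(p,p)` at every `s`) — the shape of Charles–Schnell's
arguments ("since `S` is connected, we have `α̃_s = i_s^*(a)`", proof of Prop. 11.3.5 / Cor. 11.3.6). On these
carriers it IS `AnchoredFlatSectionsQP` (`anchoredFlatSectionsQP_iff_anchoredVariationalHodgeQP`, no fact). OPEN;
a HYPOTHESIS wherever used, never asserted. [cite: CharlesSchnell2014Notes, Conj. 11.3.1 and proof of Prop. 11.3.5]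
[cite: Grothendieck1966, footnote 13] -/
@[conjecture] def AnchoredVariationalHodgeQP : Prop :=
  ∀ ⦃n : ℕ⦄ ⦃𝒳 S : SchemeOver ℂ⦄ (f : 𝒳 ⟶ S), IsSmoothProjectiveFamily f n →
    IsQuasiProjectiveOver 𝒳 → IsQuasiProjectiveOver S → IrreducibleSpace S.left →
    AlgebraicGeometry.Smooth S.hom →
    ∀ (p : ℕ) (A : complexBetti 𝒳 (2 * p)) (s₀ : ComplexPoints S),
      IsRationalClass (complexBetti.map (fiberι f s₀) (2 * p) A) →
      complexBetti.map (fiberι f s₀) (2 * p) A ∈ algebraicClasses (fiberOver f s₀) p →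
      ∀ s : ComplexPoints S, complexBetti.map (fiberι f s) (2 * p) A ∈ algebraicClasses (fiberOver f s) p

/-- **`AnchoredCompactAbelianPencilVHC` — the anchored form on compact pencils of abelian varieties**: for every
compact pencil `f : 𝒳 ⟶ S` of relative dimension `d` (`Motives.IsCompactAbelianPencil f d`: `S` a smooth
projective curve, `𝒳` smooth projective of dimension `d + 1`, `f` a smooth projective family with a section and
abelian fibres — André's «pinceau compact en variétés abéliennes», §6.3 footnote (2)), every class
`W ∈ H²ᵖ(𝒳(ℂ); ℂ)` and every `s₀` at which `W|_{𝒳_{s₀}}` is a rational algebraic class: `W|_{𝒳_s}` is algebraic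
for every `s`. The anchored form of the deform seat's `Ring2.Deform.CompactAbelianPencilVHC` (whose body,
`Abdulali1994.InvariantCyclesHoldFor f d`, also asks `W` fibrewise rational `(p,p)` EVERYWHERE) — and EQUIVALENT
to it with NO named fact (`compactAbelianPencilVHC_iff_anchoredCompactAbelianPencilVHC`: the total space is its
own smooth compactification). OPEN; a HYPOTHESIS wherever used, never asserted.
[cite: Andre1996Motifs, §6.3 footnote (2) (p. 31) and Remarque 2 (p. 33)] [cite: CharlesSchnell2014Notes, Conj. 11.3.1]
[cite: Abdulali1994FamiliesAV, (1.1) (p. 1122)] -/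
@[conjecture] def AnchoredCompactAbelianPencilVHC : Prop :=
  ∀ ⦃d : ℕ⦄ ⦃𝒳 S : SchemeOver ℂ⦄ (f : 𝒳 ⟶ S), IsCompactAbelianPencil f d →
    ∀ (p : ℕ) (W : complexBetti 𝒳 (2 * p)) (s₀ : ComplexPoints S),
      IsRationalClass (complexBetti.map (fiberι f s₀) (2 * p) W) →
      complexBetti.map (fiberι f s₀) (2 * p) W ∈ algebraicClasses (fiberOver f s₀) p →
      ∀ s : ComplexPoints S, complexBetti.map (fiberι f s) (2 * p) W ∈ algebraicClasses (fiberOver f s) p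

/-! ## §2 Fact-free wiring: the two printed-carrier anchored forms are one node; restriction to compact pencils -/

/-- **`AnchoredFlatSectionsQP ⟹ FlatSectionsAlgebraicQP`, no fact** — part b04-gen-9
`flatSectionsAlgebraicQP_of_anchoredQP` by name (a section valued in the locus of Hodge classes is rational at its
anchor). [cite: CharlesSchnell2014Notes, Conj. 11.3.1] -/
theorem flatSectionsAlgebraicQP_of_anchoredFlatSectionsQP (h : AnchoredFlatSectionsQP) :
    FlatSectionsAlgebraicQP :=
  flatSectionsAlgebraicQP_of_anchoredQP h

/-- **`AnchoredVariationalHodgeQP ⟹ VariationalHodgeQP`, no fact** (forget the Hodge-everywhere clause except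
rationality at the anchor). [cite: CharlesSchnell2014Notes, Conj. 11.3.1] -/
theorem variationalHodgeQP_of_anchoredVariationalHodgeQP (h : AnchoredVariationalHodgeQP) :
    VariationalHodgeQP := by
  intro n 𝒳 S f hf h𝒳 hS hirr hsm p A hA h₀ s
  obtain ⟨s₀, hs₀⟩ := h₀
  exact h f hf h𝒳 hS hirr hsm p A s₀ (hA s₀).1 hs₀ s

/-- **`AnchoredFlatSectionsQP ⟹ AnchoredVariationalHodgeQP`, no fact**: the global section
`s ↦ (s, A|_{𝒳_s})` of a class of the total space is a continuous section of the espace étalé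
(`continuous_globalSection`). [cite: CharlesSchnell2014Notes, Conj. 11.3.1] [cite: VoisinHodgeII2003, §3.1.2] -/
theorem anchoredVariationalHodgeQP_of_anchoredFlatSectionsQP (h : AnchoredFlatSectionsQP) :
    AnchoredVariationalHodgeQP := by
  intro n 𝒳 S f hf h𝒳 hS hirr hsm p A s₀ hrat halg s
  exact h f hf h𝒳 hS hirr hsm p (globalSection f (2 * p) A) (continuous_globalSection f (2 * p) A)
    (fun _ => rfl) s₀ hrat halg s

/-- **`AnchoredVariationalHodgeQP ⟹ AnchoredFlatSectionsQP`, no fact**: on the printed carriers a continuous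
section `σ` is the global section of ONE class `β` of the total space (Deligne 1968 / Voisin II Thm. 4.18 at one
point — the tree THEOREM `deligne1968_invariantClass_fromTotalSpace_holds` — plus the identity principle; part XXVII
`exists_globalSection_eq_of_flatSection`); `β|_{𝒳_{s₀}} = σ(s₀)` is rational algebraic, and the global-class form
transports ("since `S` is connected, we have `α̃_s = i_s^*(a)`", with the open total space in place of `X̄`).
[cite: CharlesSchnell2014Notes, proof of Prop. 11.3.5 and Cor. 11.3.6] [cite: VoisinHodgeII2003, Thm. 4.18 and Lemma 4.17] -/
theorem anchoredFlatSectionsQP_of_anchoredVariationalHodgeQP (h : AnchoredVariationalHodgeQP) :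
    AnchoredFlatSectionsQP := by
  intro n 𝒳 S f hf h𝒳 hS hirr hsm p σ hσ hpt s₀ hrat halg s
  obtain ⟨β, hσβ⟩ := exists_globalSection_eq_of_flatSection f hf h𝒳 hS hirr hsm (2 * p) hσ hpt
  -- the global class is rational and algebraic at the anchor (read off `σ`) …
  have hβrat : IsRationalClass (complexBetti.map (fiberι f s₀) (2 * p) β) :=
    fiberClass_transfer_of_eq_mk (hσβ s₀) (fun _ c => IsRationalClass c) hrat
  have hβalg : complexBetti.map (fiberι f s₀) (2 * p) β ∈ algebraicClasses (fiberOver f s₀) p :=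
    fiberClass_transfer_of_eq_mk (hσβ s₀) (fun t c => c ∈ algebraicClasses (fiberOver f t) p) halg
  -- … transport by the global-class form, read back along `σ = globalSection β`
  exact fiberClass_transfer_to_eq_mk (hσβ s) (fun t c => c ∈ algebraicClasses (fiberOver f t) p)
    (h f hf h𝒳 hS hirr hsm p β s₀ hβrat hβalg s)

/-- **On the printed carriers Conj. 11.3.1 as printed and its global-class form are ONE node — PROVED, no fact
binder** (Deligne 1968 is a tree theorem on these carriers; compare `flatSectionsAlgebraicQP_iff_variationalHodgeQP`
for the Hodge-everywhere forms). [cite: CharlesSchnell2014Notes, Conj. 11.3.1 and proof of Prop. 11.3.5]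
[cite: VoisinHodgeII2003, Thm. 4.18 and Lemma 4.17] -/
theorem anchoredFlatSectionsQP_iff_anchoredVariationalHodgeQP :
    AnchoredFlatSectionsQP ↔ AnchoredVariationalHodgeQP :=
  ⟨anchoredVariationalHodgeQP_of_anchoredFlatSectionsQP, anchoredFlatSectionsQP_of_anchoredVariationalHodgeQP⟩

/-- **Restriction to compact pencils, no fact**: `AnchoredVariationalHodgeQP ⟹ AnchoredCompactAbelianPencilVHC` (total
space and base projective, hence quasi-projective; base smooth irreducible, `Andre1996.compactPencil_smooth_base` /
`…_irreducibleSpace_base`). [cite: Andre1996Motifs, §6.3 footnote (2) (p. 31)] [cite: CharlesSchnell2014Notes, Conj. 11.3.1] -/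
theorem anchoredCompactAbelianPencilVHC_of_anchoredVariationalHodgeQP (h : AnchoredVariationalHodgeQP) :
    AnchoredCompactAbelianPencilVHC := by
  intro d 𝒳 S f hf p W s₀ hrat halg s
  exact h f hf.isSmoothProjectiveFamily
    (IsQuasiProjectiveOver.of_isProjectiveOver hf.isSmoothProjective_total.isProjectiveOver)
    (IsQuasiProjectiveOver.of_isProjectiveOver hf.isSmoothProjective_base.isProjectiveOver)
    (compactPencil_irreducibleSpace_base hf) (compactPencil_smooth_base hf) p W s₀ hrat halg s

/-- Hence also `AnchoredFlatSectionsQP ⟹ AnchoredCompactAbelianPencilVHC`, no fact. [cite: CharlesSchnell2014Notes, Conj. 11.3.1] -/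
theorem anchoredCompactAbelianPencilVHC_of_anchoredFlatSectionsQP (h : AnchoredFlatSectionsQP) : AnchoredCompactAbelianPencilVHC :=
  anchoredCompactAbelianPencilVHC_of_anchoredVariationalHodgeQP (anchoredVariationalHodgeQP_of_anchoredFlatSectionsQP h)

/-! ## §3 On compact pencils the anchored form needs no partie fixe: `CompactAbelianPencilVHC ↔ AnchoredCompactAbelianPencilVHC`, fact-free -/

/-- **(4.1.3.1) / Prop. 11.3.5 (1) on a compact pencil, NO named fact**: for a compact pencil `f : 𝒳 ⟶ S` of
relative dimension `d` and `W ∈ H²ᵖ(𝒳(ℂ); ℂ)`, if `W|_{𝒳_{s₀}}` is rational of type `(p,p)` for ONE `s₀` then it is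
for EVERY `s` — the total space is its own smooth compactification (Literature
`forall_isRationalClass_and_isOfHodgeType_of_at_of_isSmoothProjective_total`: the `(p,p)`-component of `W` restricts
like `W` at `s₀`, hence everywhere); the base curve is smooth with `S(ℂ)` connected.
[cite: DeligneHodgeII1971, (4.1.3.1) and Cor. 4.1.2 (proof)] [cite: CharlesSchnell2014Notes, Proposition 11.3.5 (1)] -/
theorem compactAbelianPencil_forall_hodge_of_hodge_at {d : ℕ} {𝒳 S : SchemeOver ℂ} {f : 𝒳 ⟶ S}
    (hf : IsCompactAbelianPencil f d) {p : ℕ} (W : complexBetti 𝒳 (2 * p)) {s₀ : ComplexPoints S}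
    (hrat : IsRationalClass (complexBetti.map (fiberι f s₀) (2 * p) W))
    (htype : IsOfHodgeType d (fiberOver f s₀) (2 * p) p p (complexBetti.map (fiberι f s₀) (2 * p) W))
    (s : ComplexPoints S) :
    IsRationalClass (complexBetti.map (fiberι f s) (2 * p) W) ∧
      IsOfHodgeType d (fiberOver f s) (2 * p) p p (complexBetti.map (fiberι f s) (2 * p) W) := by
  haveI : AlgebraicGeometry.Smooth S.hom := compactPencil_smooth_base hf
  haveI : IrreducibleSpace S.left := compactPencil_irreducibleSpace_base hf
  haveI : LocallyOfFiniteType S.hom := inferInstance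
  haveI : ConnectedSpace (ComplexPoints S) := (ComplexPoints.connectedSpace_iff_holds S).2 inferInstance
  exact forall_isRationalClass_and_isOfHodgeType_of_at_of_isSmoothProjective_total f hf.isSmoothProjectiveFamily
    hf.isSmoothProjective_total W hrat htype s

/-- **`CompactAbelianPencilVHC ⟹ AnchoredCompactAbelianPencilVHC` — NO named fact.** `W|_{𝒳_{s₀}}` rational algebraic is
of type `(p,p)` (`isOfHodgeType_of_mem_algebraicClasses_of_isSmoothProjective`, Voisin I Prop. 11.20, a tree theorem), so
`W` is fibrewise rational `(p,p)` EVERYWHERE (`compactAbelianPencil_forall_hodge_of_hodge_at` — no partie fixe: the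
pencil is compact), and the deform seat's node transports algebraicity. [cite: DeligneHodgeII1971, (4.1.3.1)]
[cite: VoisinHodgeI2002, Prop. 11.20] [cite: Andre1996Motifs, §6.3 Remarque 2 (p. 33)] -/
theorem anchoredCompactAbelianPencilVHC_of_compactAbelianPencilVHC (hV : Ring2.Deform.CompactAbelianPencilVHC) :
    AnchoredCompactAbelianPencilVHC := by
  intro d 𝒳 S f hf p W s₀ hrat halg s
  have htype : IsOfHodgeType d (fiberOver f s₀) (2 * p) p p (complexBetti.map (fiberι f s₀) (2 * p) W) :=
    isOfHodgeType_of_mem_algebraicClasses_of_isSmoothProjective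
      (hf.isSmoothProjectiveFamily.isSmoothProjective s₀) p halg
  exact hV f hf p W (fun s' => compactAbelianPencil_forall_hodge_of_hodge_at hf W hrat htype s') ⟨s₀, halg⟩ s

/-- **`AnchoredCompactAbelianPencilVHC ⟹ CompactAbelianPencilVHC`**, trivially (the Hodge-everywhere clause gives
rationality at the anchor). [cite: Andre1996Motifs, §6.3 Remarque 2 (p. 33)] -/
theorem compactAbelianPencilVHC_of_anchoredCompactAbelianPencilVHC (h : AnchoredCompactAbelianPencilVHC) :
    Ring2.Deform.CompactAbelianPencilVHC := by
  intro d 𝒳 S f hf p W hW h₀ s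
  obtain ⟨s₀, hs₀⟩ := h₀
  exact h f hf p W s₀ (hW s₀).1 hs₀ s

/-- **On compact pencils of abelian varieties the anchored (printed) form of the variational Hodge conjecture and the
tree's Hodge-everywhere form are ONE node — PROVED, no fact binder**: `Ring2.Deform.CompactAbelianPencilVHC ↔
AnchoredCompactAbelianPencilVHC`. (On the open printed carriers the same equivalence is known in the kernel only
modulo the global invariant cycle theorem, §4.) [cite: DeligneHodgeII1971, (4.1.3.1) and Cor. 4.1.2]
[cite: CharlesSchnell2014Notes, Conj. 11.3.1 and Prop. 11.3.5 (1)] [cite: Andre1996Motifs, §6.3 footnote (2)] -/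
theorem compactAbelianPencilVHC_iff_anchoredCompactAbelianPencilVHC :
    Ring2.Deform.CompactAbelianPencilVHC ↔ AnchoredCompactAbelianPencilVHC :=
  ⟨anchoredCompactAbelianPencilVHC_of_compactAbelianPencilVHC, compactAbelianPencilVHC_of_anchoredCompactAbelianPencilVHC⟩

/-- ON-PATH, fact-free: `HC_AV ⟹ AnchoredCompactAbelianPencilVHC` (the deform seat's `compactAbelianPencilVHC_of_HC_AV`,
Charles–Schnell Cor. 11.3.6 on compact pencils, then §3). [cite: CharlesSchnell2014Notes, Cor. 11.3.6] -/
theorem anchoredCompactAbelianPencilVHC_of_hc_av (h : Theses.PadicSemiregularLift.HodgeAbelianVarieties) :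
    AnchoredCompactAbelianPencilVHC :=
  anchoredCompactAbelianPencilVHC_of_compactAbelianPencilVHC (Ring2.Deform.compactAbelianPencilVHC_of_HC_AV h)

/-- ON-PATH, fact-free: the summit gives `AnchoredCompactAbelianPencilVHC`. [cite: CharlesSchnell2014Notes, Cor. 11.3.6] -/
theorem anchoredCompactAbelianPencilVHC_of_hodgeConjecture (h : _root_.HodgeConjecture) :
    AnchoredCompactAbelianPencilVHC :=
  anchoredCompactAbelianPencilVHC_of_compactAbelianPencilVHC (Ring2.Deform.compactAbelianPencilVHC_of_hodgeConjecture h)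

/-- **EXACTNESS with `HC_CM` a genuine factor: `HC_AV ↔ HC_CM ∧ AnchoredCompactAbelianPencilVHC`, granted André 1996
Lemme 6.3.1 ONLY** — the deform seat's row V′ `HC_AV_iff_HC_CM_and_compactAbelianPencilVHC_of_andre1996` with the
compact node replaced by its anchored form (§3, no further fact). `HC_CM` (`Theses.RankFourFaces.CMAbelianHodge`)
is consumed at the CM fibre of André's pencil; it is NOT restated. [cite: Andre1996Motifs, Lemme 6.3.1 (p. 31)]
[cite: CharlesSchnell2014Notes, Cor. 11.3.6] -/
theorem hc_av_iff_hc_cm_and_anchoredCompactAbelianPencilVHC_of_andre1996 (h₂₁ : andre1996_cmAnchoredPencil) :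
    Theses.PadicSemiregularLift.HodgeAbelianVarieties ↔
      (Theses.RankFourFaces.CMAbelianHodge ∧ AnchoredCompactAbelianPencilVHC) := by
  rw [← compactAbelianPencilVHC_iff_anchoredCompactAbelianPencilVHC]
  exact Ring2.Deform.HC_AV_iff_HC_CM_and_compactAbelianPencilVHC_of_andre1996 h₂₁

/-- **EXACTNESS without `HC_CM`: `HC_AV ↔ AnchoredCompactAbelianPencilVHC`, granted Lemmes 6.3.1–6.3.3** — the deform
seat's (E₂′) `HC_AV_iff_compactAbelianPencilVHC_of_andre1996` through §3. [cite: Andre1996Motifs, §6.3 Remarque 2 (p. 33)]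
[cite: CharlesSchnell2014Notes, Cor. 11.3.6] -/
theorem hc_av_iff_anchoredCompactAbelianPencilVHC_of_andre1996 (h₂₁ : andre1996_cmAnchoredPencil)
    (h₂₂ : andre1996_cmHodgeClasses_algebraicallyAnchoredPencils) :
    Theses.PadicSemiregularLift.HodgeAbelianVarieties ↔ AnchoredCompactAbelianPencilVHC := by
  rw [← compactAbelianPencilVHC_iff_anchoredCompactAbelianPencilVHC]
  exact Ring2.Deform.HC_AV_iff_compactAbelianPencilVHC_of_andre1996 h₂₁ h₂₂

/-- **Item 16267 (`CMToAbelian`) `↔ (HC_CM → AnchoredCompactAbelianPencilVHC)`, granted Lemme 6.3.1** — the deform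
seat's `cmToAbelian_iff_HC_CM_imp_compactAbelianPencilVHC` through §3: under `HC_CM`, the open reduction item is
Conj. 11.3.1 AS PRINTED on compact pencils of abelian varieties. A typed conditional toward the item; nothing closes
it. [cite: Andre1996Motifs, Lemme 6.3.1 (p. 31)] [cite: CharlesSchnell2014Notes, Conj. 11.3.1 and Cor. 11.3.6] -/
theorem cmToAbelian_iff_hc_cm_imp_anchoredCompactAbelianPencilVHC_of_andre1996 (h₂₁ : andre1996_cmAnchoredPencil) :
    Theses.RankFourFaces.CMToAbelian ↔
      (Theses.RankFourFaces.CMAbelianHodge → AnchoredCompactAbelianPencilVHC) := by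
  rw [← compactAbelianPencilVHC_iff_anchoredCompactAbelianPencilVHC]
  exact Ring2.Deform.cmToAbelian_iff_HC_CM_imp_compactAbelianPencilVHC h₂₁

/-! ## §4 Modulo the global invariant cycle theorem on the printed carriers; rows -/

/-- **Modulo Thm. 11.3.4 the printed-carrier binder IS Conj. 11.3.1 as printed: `FlatSectionsAlgebraicQP ↔
AnchoredFlatSectionsQP`** — part b04-gen-9 `flatSectionsAlgebraicQP_iff_anchoredQP_of_deligne` by name.
[cite: CharlesSchnell2014Notes, Conj. 11.3.1, Thm. 11.3.4 and Prop. 11.3.5 (1)] -/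
theorem flatSectionsAlgebraicQP_iff_anchoredFlatSectionsQP_of_deligne (hD : deligne_globalInvariantCycles) :
    FlatSectionsAlgebraicQP ↔ AnchoredFlatSectionsQP :=
  flatSectionsAlgebraicQP_iff_anchoredQP_of_deligne hD

/-- **Modulo Thm. 11.3.4, `VariationalHodgeQP ↔ AnchoredVariationalHodgeQP`** (through
`flatSectionsAlgebraicQP_iff_variationalHodgeQP`, §4's first `↔`, and §2 — the two outer links fact-free).
[cite: CharlesSchnell2014Notes, Conj. 11.3.1, Thm. 11.3.4 and Prop. 11.3.5 (1)] [cite: DeligneHodgeII1971, (4.1.3.1)] -/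
theorem variationalHodgeQP_iff_anchoredVariationalHodgeQP_of_deligne (hD : deligne_globalInvariantCycles) :
    VariationalHodgeQP ↔ AnchoredVariationalHodgeQP :=
  flatSectionsAlgebraicQP_iff_variationalHodgeQP.symm.trans
    ((flatSectionsAlgebraicQP_iff_anchoredFlatSectionsQP_of_deligne hD).trans
      anchoredFlatSectionsQP_iff_anchoredVariationalHodgeQP)

/-- Row b04's binder gives Conj. 11.3.1 as printed, granted Thm. 11.3.4: `FlatSectionsAlgebraic ⟹
AnchoredFlatSectionsQP` (part b04-gen-9 `anchoredQP_of_flatSectionsAlgebraic_of_deligne` by name).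
[cite: CharlesSchnell2014Notes, Conj. 11.3.1 and Prop. 11.3.5 (1)] -/
theorem anchoredFlatSectionsQP_of_flatSectionsAlgebraic_of_deligne (hD : deligne_globalInvariantCycles)
    (hF : FlatSectionsAlgebraic) : AnchoredFlatSectionsQP :=
  anchoredQP_of_flatSectionsAlgebraic_of_deligne hD hF

/-- Item 1076 gives the anchored global-class form, granted Thm. 11.3.4: `VHC ⟹ AnchoredVariationalHodgeQP`.
[cite: CharlesSchnell2014Notes, Conj. 11.3.1 and Prop. 11.3.5 (1)] [cite: Grothendieck1966, footnote 13] -/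
theorem anchoredVariationalHodgeQP_of_vhc_of_deligne (hD : deligne_globalInvariantCycles)
    (hV : Theses.AnchorTransport.VariationalHodge) : AnchoredVariationalHodgeQP :=
  (variationalHodgeQP_iff_anchoredVariationalHodgeQP_of_deligne hD).1 (variationalHodgeQP_of_vhc hV)

/-- ON-PATH: the summit gives `AnchoredFlatSectionsQP`, granted Thm. 11.3.4 (Charles–Schnell Cor. 11.3.6, whose printed
proof uses exactly Prop. 11.3.5). [cite: CharlesSchnell2014Notes, Cor. 11.3.6] -/
theorem anchoredFlatSectionsQP_of_hodgeConjecture_of_deligne (hD : deligne_globalInvariantCycles)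
    (h : _root_.HodgeConjecture) : AnchoredFlatSectionsQP :=
  anchoredQP_of_hodgeConjecture_of_deligne hD h

/-- ON-PATH: the summit gives `AnchoredVariationalHodgeQP`, granted Thm. 11.3.4. [cite: CharlesSchnell2014Notes, Cor. 11.3.6] -/
theorem anchoredVariationalHodgeQP_of_hodgeConjecture_of_deligne (hD : deligne_globalInvariantCycles)
    (h : _root_.HodgeConjecture) : AnchoredVariationalHodgeQP :=
  anchoredVariationalHodgeQP_of_anchoredFlatSectionsQP (anchoredQP_of_hodgeConjecture_of_deligne hD h)

/-- **Row: `HC_CM ∧ AnchoredFlatSectionsQP ⟹ HC_AV`, modulo André 1996 Lemme 6.3.1 only** (part b04-gen-9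
`hc_av_of_andre1996_of_hc_cm_of_anchoredQP` by name; no partie fixe in this direction). `HC_CM` is a HYPOTHESIS.
[cite: Andre1996Motifs, Lemme 6.3.1 (p. 31)] [cite: CharlesSchnell2014Notes, Conj. 11.3.1] -/
theorem hc_av_of_andre1996_of_hc_cm_of_anchoredFlatSectionsQP (h₂₁ : andre1996_cmAnchoredPencil)
    (hCM : Theses.RankFourFaces.CMAbelianHodge) (hA : AnchoredFlatSectionsQP) :
    Theses.PadicSemiregularLift.HodgeAbelianVarieties :=
  hc_av_of_andre1996_of_hc_cm_of_anchoredQP h₂₁ hCM hA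

/-- **Row: `HC_CM ∧ AnchoredVariationalHodgeQP ⟹ HC_AV`, modulo Lemme 6.3.1 only** (§2, then part XXVII's row).
[cite: Andre1996Motifs, Lemme 6.3.1 (p. 31)] [cite: CharlesSchnell2014Notes, Conj. 11.3.1] -/
theorem hc_av_of_andre1996_of_hc_cm_of_anchoredVariationalHodgeQP (h₂₁ : andre1996_cmAnchoredPencil)
    (hCM : Theses.RankFourFaces.CMAbelianHodge) (hA : AnchoredVariationalHodgeQP) :
    Theses.PadicSemiregularLift.HodgeAbelianVarieties :=
  hc_av_of_andre1996_of_hc_cm_of_variationalHodgeQP h₂₁ hCM (variationalHodgeQP_of_anchoredVariationalHodgeQP hA)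

/-- **Row: `HC_CM ∧ AnchoredCompactAbelianPencilVHC ⟹ HC_AV`, modulo Lemme 6.3.1 only** (§3, then the deform seat's
row V′). [cite: Andre1996Motifs, Lemme 6.3.1 (p. 31)] [cite: Abdulali1994FamiliesAV, Lemma 6.2 (p. 1131)] -/
theorem hc_av_of_andre1996_of_hc_cm_of_anchoredCompactAbelianPencilVHC (h₂₁ : andre1996_cmAnchoredPencil)
    (hCM : Theses.RankFourFaces.CMAbelianHodge) (hA : AnchoredCompactAbelianPencilVHC) :
    Theses.PadicSemiregularLift.HodgeAbelianVarieties :=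
  Ring2.Deform.HC_AV_of_andre1996_of_HC_CM_of_compactAbelianPencilVHC h₂₁ hCM
    (compactAbelianPencilVHC_of_anchoredCompactAbelianPencilVHC hA)

/-- **HONEST COLUMN: on the printed-carrier rows `HC_CM` is DOMINATED** — `AnchoredVariationalHodgeQP ⟹ HC_CM` modulo
{André 1992, Deligne's tensor-anchored Weil families, R3anc} (part XXVII `hc_cm_of_variationalHodgeQP`, the anchored
node being stronger than `VariationalHodgeQP`). [cite: Andre1996Motifs, §6.3 Lemmes 6.3.2–6.3.3 and Remarque 2]
[cite: Andre1992HodgeCM, Théorème] [cite: Deligne1982HodgeCycles, Thm. 4.8] -/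
theorem hc_cm_of_anchoredVariationalHodgeQP
    (h𝔄 : Andre1992_hodgeClasses_cmAbelianVariety_mem_span_pullback_weilClasses)
    (hD : deligne1982_weilFamily_hodgeWeilSection_all) (hanc : WeilTypeLadder.AnchoredWeilFamiliesCMField)
    (hA : AnchoredVariationalHodgeQP) : Theses.RankFourFaces.CMAbelianHodge :=
  hc_cm_of_variationalHodgeQP h𝔄 hD hanc (variationalHodgeQP_of_anchoredVariationalHodgeQP hA)

/-- **HONEST COLUMN on compact pencils: `AnchoredCompactAbelianPencilVHC ⟹ HC_CM` granted Lemmes 6.3.2–6.3.3 only** (the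
deform seat's (D′) `HC_CM_of_andre1996_of_compactAbelianPencilVHC` through §3).
[cite: Andre1996Motifs, Lemmes 6.3.2–6.3.3 and Remarque 2 (pp. 32–33)] -/
theorem hc_cm_of_andre1996_of_anchoredCompactAbelianPencilVHC
    (h₂₂ : andre1996_cmHodgeClasses_algebraicallyAnchoredPencils) (hA : AnchoredCompactAbelianPencilVHC) :
    Theses.RankFourFaces.CMAbelianHodge :=
  Ring2.Deform.HC_CM_of_andre1996_of_compactAbelianPencilVHC h₂₂
    (compactAbelianPencilVHC_of_anchoredCompactAbelianPencilVHC hA)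

/-- **The row with `HC_CM` discharged by print: `AnchoredVariationalHodgeQP ⟹ HC_AV` granted André 1996 Lemmes
6.3.1–6.3.3, NO `HC_CM` binder** — restriction to compact pencils (§2, fact-free), then
`hc_av_iff_anchoredCompactAbelianPencilVHC_of_andre1996` (§3 + the deform seat's (E₂′)). Compare part XXVII's
`hc_av_of_flatSectionsAlgebraicQP` (modulo {Lemme 6.3.1, André 1992, Deligne 1982 all-`n`, R3anc}).
[cite: Andre1996Motifs, §6.3 Lemmes 6.3.1–6.3.3 and Remarque 2 (pp. 31–33)] -/
theorem hc_av_of_andre1996_of_anchoredVariationalHodgeQP (h₂₁ : andre1996_cmAnchoredPencil)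
    (h₂₂ : andre1996_cmHodgeClasses_algebraicallyAnchoredPencils) (hA : AnchoredVariationalHodgeQP) :
    Theses.PadicSemiregularLift.HodgeAbelianVarieties :=
  (hc_av_iff_anchoredCompactAbelianPencilVHC_of_andre1996 h₂₁ h₂₂).2
    (anchoredCompactAbelianPencilVHC_of_anchoredVariationalHodgeQP hA)

/-- The same from Conj. 11.3.1 as printed: `AnchoredFlatSectionsQP ⟹ HC_AV` granted Lemmes 6.3.1–6.3.3, no `HC_CM`
binder. [cite: Andre1996Motifs, §6.3 Remarque 2 (p. 33)] [cite: CharlesSchnell2014Notes, Conj. 11.3.1] -/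
theorem hc_av_of_andre1996_of_anchoredFlatSectionsQP (h₂₁ : andre1996_cmAnchoredPencil)
    (h₂₂ : andre1996_cmHodgeClasses_algebraicallyAnchoredPencils) (hA : AnchoredFlatSectionsQP) :
    Theses.PadicSemiregularLift.HodgeAbelianVarieties :=
  hc_av_of_andre1996_of_anchoredVariationalHodgeQP h₂₁ h₂₂ (anchoredVariationalHodgeQP_of_anchoredFlatSectionsQP hA)

/-! ## Audit: three `@[conjecture] def` obligation nodes (never asserted); no named fact; no `sorry`; every theorem
concluding `HC_AV` or `HC_CM` carries open named inputs as hypotheses. Axiom closures: standard. -/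

#print axioms Summit.HodgeConjecture.HodgeConjecture.Ring2.Hypotheses.compactAbelianPencilVHC_iff_anchoredCompactAbelianPencilVHC
#print axioms Summit.HodgeConjecture.HodgeConjecture.Ring2.Hypotheses.hc_av_iff_hc_cm_and_anchoredCompactAbelianPencilVHC_of_andre1996

end Summit.HodgeConjecture.HodgeConjecture.Ring2.Hypotheses

end
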